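import Literature.NumberTheory.LFunctions.Zhang2022.RepairSmoothBandEdge
import Literature.NumberTheory.LFunctions.Zhang2022.RepairRplusWallZero
import Literature.NumberTheory.LFunctions.Zhang2022.SkeletonAssembly

/-!
# Zhang (2022) §18-margin repair rung — barrier extension `R⁺⁺`: the E-004 slot ON THE TRUE BAND ONLY
# (`P ≤ n ≤ D·P·𝓛^m`, main scale) and the from-the-wall family it closes — the seam in its final form

Trunk T-ANT (NumberTheory/LFunctions). Y. Zhang, *Discrete mean estimates and the Landau–Siegel
zero*, arXiv:2211.02515v1 (2022) [Zhang2022LandauSiegel] — **an unrefereed manuscript under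
adjudication. WHAT THIS IS NOT: nothing here asserts or denies its Theorems 1–2 or any analytic lemma;
no claim about Landau–Siegel zeros, about Parity, or about a repaired `Margin232` is made; `DiscMeanTrueBand` below is
an E*-SLOT (hypothesis shape, registry E-004 at the main scale, restricted to the true band), displayed where used,
NEVER asserted.** Cell `landau-siegel` (rung F-S3), sub-cell E, seat ls-barrier-p2 g2.

After the band-scale invisibility rows (`KnifeEdgeInvisibleTail.discMeanFlat_bandEdge(_lipschitzOn/_topVanishing)`,
p469409/p470027; `Repair.familyBandEdge`, p469716) everything beyond the TRUE band edge `n ≥ D·P·𝓛^{1058+2A}`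
(`z ≥ 1 + α̃ + O(log𝓛/𝓛⁹)`) is decided WITHOUT slot. What is left of the E-004 seam is the band itself. This file types
the slot THERE and nowhere else, at the MAIN scale, and closes the from-the-wall family with it:

* `DiscMeanTrueBandOn V c′ m η` / `DiscMeanTrueBand c′ m η` (wall-zero class; kind (c); NOT asserted): for all large
  `D`, under the displayed `Re ρ = ½`, for every profile of the class and EVERY length `⌈P⌉ ≤ N ≤ ⌈D·P·𝓛^m⌉ + 1`
  (every partial block of the true band): `|discMean(N) − discMean(⌈P⌉)| ≤ η·(discMeanAbs(⌈P⌉) + 𝔞𝔓)` — the registry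
  sentence E-004 «the band piece `z ∈ (1, 1+α̃]` of a smooth top-vanishing profile contributes negligibly» at the
  main scale (expected true for every `m`, `η > 0`: the band height of a wall-vanishing 1-Lipschitz profile is
  `≲ 𝓛⁻⁸`, theory custodian 2026-08-26T11:35:37Z «safe iff 𝔞 ≫ 𝓛^{−5.9}»; derivation = a discrete mean-value upper bound
  at the sampled zeros, NOT in tree); its negation = a band MAIN TERM for a wall-vanishing profile = E*-strength.
* `discMean_fromWall_of_trueBandOn`: slot at `(m, η)` with `m = 1058 + 2A` + band-edge flatness ⇒ eventually, under (b),
  for EVERY `⌈P⌉ ≤ N ≤ ⌈P^{1+δ}⌉`: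
  `|discMean(N) − discMean(⌈P⌉)| ≤ η·(discMeanAbs⌈P⌉ + 𝔞𝔓) + 𝓛^{−A}·(discMeanAbs(⌈D·P·𝓛^m⌉+1) + discWeight)`;
  `discMean_fromWall_topVanishing_of_trueBandOn`: every `N ≥ ⌈P⌉` for a top-vanishing profile.
* rows `Repair.familyWallZeroTrueBand` / `familyWallZeroTopTrueBand` (Design/InClass = `WallZeroDesign`/`WallZeroTopDesign`
  of p459259 UNCHANGED; C4 `inClass_triangle`/`inClassTop_triangle` by name), `_decided`, `rplus_wallZeroTrueBand_decided`.
  READING: closing past the wall by a main-order amount in the smooth wall-zero class (disc-mean currency) needs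
  `¬ DiscMeanTrueBand c′ m η` for some `(m, η)` — a main term located IN THE α̃-BAND — and nothing else; by the units
  lemma (`discWeight ≤ 3𝓛⁹𝔓`, p467613) the `𝓛^{−A}` tail term is `o(𝔞𝔓)` for `A ≥ 10`.

CURRENCY (REF-E C3(e)): discrete mean; (b) `Re ρ = ½` and (c) `DiscMeanTrueBand` displayed.

## References

* Y. Zhang, arXiv:2211.02515v1 (2022), §2 (2.14)–(2.20), (2.30)–(2.31), §7 (7.2) [p. 44], §8 Lemma 8.1.
  [cite: Zhang2022LandauSiegel, §§2, 7, 8]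
-/

noncomputable section

open Real Complex
open scoped NNReal

namespace Literature.NumberTheory.LFunctions.Zhang2022

namespace Repair

/-- The true band edge as a length: `⌈D·P·𝓛^m⌉ + 1`. [cite: Zhang2022LandauSiegel, §2 (2.30)] -/
def bandEdge (D : ℕ) (m : ℕ) : ℕ := ⌈(D : ℝ) * Skeleton.bigP D * Skeleton.ell D ^ m⌉₊ + 1

/-- `⌈P⌉ ≤ ⌈D·P·𝓛^m⌉ + 1` once `D ≥ 3` (`D·𝓛^m ≥ 1`). [cite: Zhang2022LandauSiegel, §2 (2.30)] -/
theorem ceil_bigP_le_bandEdge {D : ℕ} (hD : 3 ≤ D) (m : ℕ) : ⌈Skeleton.bigP D⌉₊ ≤ bandEdge D m := by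
  unfold bandEdge
  have hℓ1 : 1 ≤ Skeleton.ell D := (Skeleton.one_lt_ell hD).le
  have hD1 : (1 : ℝ) ≤ D := by exact_mod_cast le_trans (by norm_num) hD
  have hP : 0 < Skeleton.bigP D := Real.exp_pos _
  have h : Skeleton.bigP D ≤ (D : ℝ) * Skeleton.bigP D * Skeleton.ell D ^ m := by
    have h1 : (1 : ℝ) ≤ (D : ℝ) * Skeleton.ell D ^ m := by
      calc (1 : ℝ) = 1 * 1 := by ring
        _ ≤ (D : ℝ) * Skeleton.ell D ^ m := mul_le_mul hD1 (one_le_pow₀ hℓ1) zero_le_one (by linarith)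
    calc Skeleton.bigP D = Skeleton.bigP D * 1 := (mul_one _).symm
      _ ≤ Skeleton.bigP D * ((D : ℝ) * Skeleton.ell D ^ m) := mul_le_mul_of_nonneg_left h1 hP.le
      _ = (D : ℝ) * Skeleton.bigP D * Skeleton.ell D ^ m := by ring
  exact (Nat.ceil_mono h).trans (Nat.le_succ _)

/-! ### The slot on the true band (main scale) -/

/-- **E-004 ON THE TRUE BAND, MAIN SCALE, over a profile class `V`** (hypothesis shape; NOT asserted): eventually,
under the displayed `Re ρ = ½`, for every `g` with `V g` and every length `⌈P⌉ ≤ N ≤ ⌈D·P·𝓛^m⌉ + 1`,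
`|discMean(N) − discMean(⌈P⌉)| ≤ η·(discMeanAbs(⌈P⌉) + 𝔞𝔓)`. [cite: Zhang2022LandauSiegel, §2 (2.16)–(2.20), (2.30)–(2.31)] -/
def DiscMeanTrueBandOn (V : (ℝ → ℂ) → Prop) (c' : ℝ) (m : ℕ) (η : ℝ) : Prop :=
  Skeleton.ForAllLarge fun D _ χ =>
    (∀ i ∈ Skeleton.idx χ, (i.2).re = 1 / 2) →
      ∀ g : ℝ → ℂ, V g → ∀ N : ℕ, ⌈Skeleton.bigP D⌉₊ ≤ N → N ≤ bandEdge D m →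
        |discMean c' χ g N - discMean c' χ g ⌈Skeleton.bigP D⌉₊| ≤
          η * (discMeanAbs c' χ g ⌈Skeleton.bigP D⌉₊ + Skeleton.frakA χ * frakP D)

/-- **E-004 ON THE TRUE BAND, SLOT OF RECORD for the wall-value-zero class** (globally 1-Lipschitz, `‖g‖ ≤ 1`,
`g(1) = 0`; hypothesis shape; NOT asserted). [cite: Zhang2022LandauSiegel, §2 (2.16)–(2.20), (2.30)–(2.31)] -/
def DiscMeanTrueBand (c' : ℝ) (m : ℕ) (η : ℝ) : Prop :=
  DiscMeanTrueBandOn (fun g => LipschitzWith 1 g ∧ (∀ z, ‖g z‖ ≤ 1) ∧ g 1 = 0) c' m η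

/-- The true-band slot is antitone in the class. [cite: Zhang2022LandauSiegel, §2 (2.16)–(2.20)] -/
theorem DiscMeanTrueBandOn.anti {V V' : (ℝ → ℂ) → Prop} {c' : ℝ} {m : ℕ} {η : ℝ} (hVV : ∀ g, V g → V' g)
    (h : DiscMeanTrueBandOn V' c' m η) : DiscMeanTrueBandOn V c' m η :=
  Skeleton.ForAllLarge.mono h fun _ _ _ _ _ hB hA g hg => hB hA g (hVV g hg)

/-! ### From the wall to any length, conditionally on the true-band slot only -/

/-- **From the wall to any length `≤ ⌈P^{1+δ}⌉`, conditionally on the TRUE-BAND slot over a class `V` of profiles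
1-Lipschitz and bounded by `1` on `[1, ∞)`** (slot at `m = 1058 + 2A`; beyond the band edge the band-scale flatness,
p470027, takes over with saving `𝓛^{−A}`): eventually, under (b), for every `g` with `V g` and every `⌈P⌉ ≤ N ≤ ⌈P^{1+δ}⌉`,
`|discMean(N) − discMean(⌈P⌉)| ≤ η·(discMeanAbs⌈P⌉ + 𝔞𝔓) + 𝓛^{−A}·(discMeanAbs(bandEdge) + discWeight)`.
[cite: Zhang2022LandauSiegel, §2 (2.16)–(2.20), (2.30); §8 Lemma 8.1] -/
theorem discMean_fromWall_of_trueBandOn {V : (ℝ → ℂ) → Prop} (c' : ℝ) {δ : ℝ} (hδ : 0 < δ) (A : ℕ) {η : ℝ}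
    (hV : ∀ g, V g → LipschitzOnWith 1 g (Set.Ici 1) ∧ ∀ z : ℝ, 1 ≤ z → ‖g z‖ ≤ 1)
    (hB : DiscMeanTrueBandOn V c' (1058 + 2 * A) η) :
    Skeleton.ForAllLarge fun D _ χ =>
      (∀ i ∈ Skeleton.idx χ, (i.2).re = 1 / 2) →
        ∀ g : ℝ → ℂ, V g → ∀ N : ℕ, ⌈Skeleton.bigP D⌉₊ ≤ N → N ≤ ⌈Skeleton.bigP D ^ (1 + δ)⌉₊ →
          |discMean c' χ g N - discMean c' χ g ⌈Skeleton.bigP D⌉₊| ≤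
            η * (discMeanAbs c' χ g ⌈Skeleton.bigP D⌉₊ + Skeleton.frakA χ * frakP D) +
              (Skeleton.ell D ^ A)⁻¹ * (discMeanAbs c' χ g (bandEdge D (1058 + 2 * A)) + discWeight c' χ) := by
  refine ((Skeleton.ForAllLarge.and hB
    (KnifeEdgeInvisibleTail.discMeanFlat_bandEdge_lipschitzOn c' hδ A)).and
      (Skeleton.ForAllLarge.of_le 3 fun D _ _ hD _ _ => hD)).mono ?_
  intro D _ χ _ _ h hA g hg N hN₁ hN₂
  obtain ⟨⟨hband, hflat⟩, hD3⟩ := h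
  have hℓ : 0 ≤ (Skeleton.ell D ^ A)⁻¹ :=
    inv_nonneg.mpr (pow_nonneg (zero_le_one.trans (Skeleton.one_lt_ell hD3).le) A)
  have hT0 : 0 ≤ (Skeleton.ell D ^ A)⁻¹ * (discMeanAbs c' χ g (bandEdge D (1058 + 2 * A)) + discWeight c' χ) :=
    mul_nonneg hℓ (add_nonneg (Finset.sum_nonneg fun _ _ => mul_nonneg (abs_nonneg _) (sq_nonneg _))
      (Finset.sum_nonneg fun _ _ => abs_nonneg _))
  by_cases hNb : N ≤ bandEdge D (1058 + 2 * A)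
  · -- inside the band: the slot alone
    exact (hband hA g hg N hN₁ hNb).trans (le_add_of_nonneg_right hT0)
  · -- beyond the band edge: slot at the edge + band-scale flatness
    have hNb' : bandEdge D (1058 + 2 * A) ≤ N := (not_le.mp hNb).le
    have hE₁ : ⌈Skeleton.bigP D⌉₊ ≤ bandEdge D (1058 + 2 * A) := ceil_bigP_le_bandEdge hD3 _
    have h1 := hband hA g hg (bandEdge D (1058 + 2 * A)) hE₁ le_rfl
    have h2 := hflat hA g 1 1 (hV g hg).1 (hV g hg).2 (bandEdge D (1058 + 2 * A)) N le_rfl hNb' hN₂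
    have h2' : |discMean c' χ g N - discMean c' χ g (bandEdge D (1058 + 2 * A))| ≤
        (Skeleton.ell D ^ A)⁻¹ * (discMeanAbs c' χ g (bandEdge D (1058 + 2 * A)) + discWeight c' χ) := by
      simpa using h2
    calc |discMean c' χ g N - discMean c' χ g ⌈Skeleton.bigP D⌉₊|
        = |(discMean c' χ g (bandEdge D (1058 + 2 * A)) - discMean c' χ g ⌈Skeleton.bigP D⌉₊) +
            (discMean c' χ g N - discMean c' χ g (bandEdge D (1058 + 2 * A)))| := by ring_nf
      _ ≤ |discMean c' χ g (bandEdge D (1058 + 2 * A)) - discMean c' χ g ⌈Skeleton.bigP D⌉₊| +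
            |discMean c' χ g N - discMean c' χ g (bandEdge D (1058 + 2 * A))| := abs_add_le _ _
      _ ≤ _ := add_le_add h1 h2'

/-- **From the wall to the FULL polynomial of a top-vanishing piece** (`g = 0` on `[θ, ∞)`; `δ := |θ − 1| + 1`),
conditionally on the true-band slot over `V` only: every `N ≥ ⌈P⌉`. [cite: Zhang2022LandauSiegel, §2 (2.16)–(2.20); §8 Lemma 8.1] -/
theorem discMean_fromWall_topVanishing_of_trueBandOn {V : (ℝ → ℂ) → Prop} (c' : ℝ) (θ : ℝ) (A : ℕ) {η : ℝ}
    (hV : ∀ g, V g → LipschitzOnWith 1 g (Set.Ici 1) ∧ ∀ z : ℝ, 1 ≤ z → ‖g z‖ ≤ 1)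
    (hB : DiscMeanTrueBandOn V c' (1058 + 2 * A) η) :
    Skeleton.ForAllLarge fun D _ χ =>
      (∀ i ∈ Skeleton.idx χ, (i.2).re = 1 / 2) →
        ∀ g : ℝ → ℂ, V g → (∀ z, θ ≤ z → g z = 0) → ∀ N : ℕ, ⌈Skeleton.bigP D⌉₊ ≤ N →
          |discMean c' χ g N - discMean c' χ g ⌈Skeleton.bigP D⌉₊| ≤
            η * (discMeanAbs c' χ g ⌈Skeleton.bigP D⌉₊ + Skeleton.frakA χ * frakP D) +
              (Skeleton.ell D ^ A)⁻¹ * (discMeanAbs c' χ g (bandEdge D (1058 + 2 * A)) + discWeight c' χ) := by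
  have hδ : 0 < |θ - 1| + 1 := by have := abs_nonneg (θ - 1); linarith
  have hθ : θ ≤ 1 + (|θ - 1| + 1) := by have := le_abs_self (θ - 1); linarith
  refine ((discMean_fromWall_of_trueBandOn c' hδ A hV hB).and
      (Skeleton.ForAllLarge.of_le 3 fun D _ _ hD _ _ => hD)).mono ?_
  intro D _ χ _ _ h hA g hg hg0 N hN₁
  obtain ⟨hwall, hD3⟩ := h
  by_cases hNδ : N ≤ ⌈Skeleton.bigP D ^ (1 + (|θ - 1| + 1))⌉₊
  · exact hwall hA g hg N hN₁ hNδ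
  · -- beyond `⌈P^{1+δ}⌉` the profile vanishes, so the polynomial (hence the mean) is that of length `⌈P^{1+δ}⌉`
    have hNδ' : ⌈Skeleton.bigP D ^ (1 + (|θ - 1| + 1))⌉₊ ≤ N := (not_le.mp hNδ).le
    have hℓ0 : 0 < Skeleton.ell D := zero_lt_one.trans (Skeleton.one_lt_ell hD3)
    have hP : 0 < Skeleton.bigP D := Real.exp_pos _
    have hlogPpos : 0 < Real.log (Skeleton.bigP D) := by
      rw [Skeleton.bigP, Real.log_exp]; exact pow_pos hℓ0 9
    have hNδ1 : 1 ≤ ⌈Skeleton.bigP D ^ (1 + (|θ - 1| + 1))⌉₊ :=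
      Nat.one_le_ceil_iff.mpr (Real.rpow_pos_of_pos hP _)
    have hpoly : ∀ (x : Skeleton.Chr D) (s : ℂ),
        profPoly χ x g N s = profPoly χ x g ⌈Skeleton.bigP D ^ (1 + (|θ - 1| + 1))⌉₊ s := by
      intro x s
      simp only [profPoly]
      rw [← Finset.sum_Ico_consecutive _ hNδ1 hNδ']
      have hzero : ∑ n ∈ Finset.Ico ⌈Skeleton.bigP D ^ (1 + (|θ - 1| + 1))⌉₊ N,
          Skeleton.pc χ x n * g (Real.log n / Real.log (Skeleton.bigP D)) * (n : ℂ) ^ (-s) = 0 := by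
        refine Finset.sum_eq_zero fun n hn => ?_
        have hn : ⌈Skeleton.bigP D ^ (1 + (|θ - 1| + 1))⌉₊ ≤ n := (Finset.mem_Ico.mp hn).1
        have hnr : Skeleton.bigP D ^ (1 + (|θ - 1| + 1)) ≤ (n : ℝ) :=
          (Nat.le_ceil _).trans (by exact_mod_cast hn)
        have hθn : θ ≤ Real.log n / Real.log (Skeleton.bigP D) := by
          rw [le_div_iff₀ hlogPpos]
          have h1 := Real.log_le_log (Real.rpow_pos_of_pos hP _) hnr
          rw [Real.log_rpow hP] at h1
          calc θ * Real.log (Skeleton.bigP D) ≤ (1 + (|θ - 1| + 1)) * Real.log (Skeleton.bigP D) :=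
                mul_le_mul_of_nonneg_right hθ hlogPpos.le
            _ ≤ Real.log n := h1
        rw [hg0 _ hθn]; ring
      rw [hzero, add_zero]
    have hmean : discMean c' χ g N = discMean c' χ g ⌈Skeleton.bigP D ^ (1 + (|θ - 1| + 1))⌉₊ := by
      simp only [discMean, hpoly]
    rw [hmean]
    have hPle : ⌈Skeleton.bigP D⌉₊ ≤ ⌈Skeleton.bigP D ^ (1 + (|θ - 1| + 1))⌉₊ := by
      refine Nat.ceil_mono ?_
      have hP1 : 1 ≤ Skeleton.bigP D := by
        rw [Skeleton.bigP]; exact Real.one_le_exp (pow_nonneg hℓ0.le 9)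
      calc Skeleton.bigP D = Skeleton.bigP D ^ (1:ℝ) := (Real.rpow_one _).symm
        _ ≤ Skeleton.bigP D ^ (1 + (|θ - 1| + 1)) := Real.rpow_le_rpow_of_exponent_le hP1 (by linarith)
    exact hwall hA g hg _ hPle le_rfl

/-! ### The from-the-wall families conditional on the true-band slot only -/

/-- **Verdict (true band)**: for every `δ > 0`, `A`, `η`, IF the true-band slot `DiscMeanTrueBand c′ (1058+2A) η` holds,
then eventually, under (b), for EVERY `⌈P⌉ ≤ N ≤ ⌈P^{1+δ}⌉`:
`¬ (η·(discMeanAbs⌈P⌉ + 𝔞𝔓) + 𝓛^{−A}·(discMeanAbs(bandEdge) + discWeight) < |discMean N − discMean ⌈P⌉|)`.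
[cite: Zhang2022LandauSiegel, §2 (2.16)–(2.20), (2.30)–(2.31); §8 Lemma 8.1] -/
def WallZeroDesign.VerdictTrueBand (d : WallZeroDesign) : Prop :=
  ∀ ⦃δ : ℝ⦄, 0 < δ → ∀ (A : ℕ) (η : ℝ), DiscMeanTrueBand d.c' (1058 + 2 * A) η →
    Skeleton.ForAllLarge fun D _ χ =>
      (∀ i ∈ Skeleton.idx χ, (i.2).re = 1 / 2) →
        ∀ N : ℕ, ⌈Skeleton.bigP D⌉₊ ≤ N → N ≤ ⌈Skeleton.bigP D ^ (1 + δ)⌉₊ →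
          ¬ (η * (discMeanAbs d.c' χ d.g ⌈Skeleton.bigP D⌉₊ + Skeleton.frakA χ * frakP D) +
                (Skeleton.ell D ^ A)⁻¹ *
                  (discMeanAbs d.c' χ d.g (bandEdge D (1058 + 2 * A)) + discWeight d.c' χ) <
              |discMean d.c' χ d.g N - discMean d.c' χ d.g ⌈Skeleton.bigP D⌉₊|)

/-- The wall-value-zero class restricts to «1-Lipschitz and bounded by `1` on `[1, ∞)`». [cite: Zhang2022LandauSiegel, §7 (7.2) p.44] -/
private theorem wallZeroClass_restrict' (g : ℝ → ℂ) (hg : LipschitzWith 1 g ∧ (∀ z, ‖g z‖ ≤ 1) ∧ g 1 = 0) :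
    LipschitzOnWith 1 g (Set.Ici 1) ∧ ∀ z : ℝ, 1 ≤ z → ‖g z‖ ≤ 1 :=
  ⟨hg.1.lipschitzOnWith, fun z _ => hg.2.1 z⟩

/-- **The slice theorem (true band).** [cite: Zhang2022LandauSiegel, §2 (2.16)–(2.20); §8 Lemma 8.1] -/
theorem WallZeroDesign.verdictTrueBand_of_inClass (d : WallZeroDesign) (h : d.InClass) : d.VerdictTrueBand := by
  intro δ hδ A η hB
  refine (discMean_fromWall_of_trueBandOn d.c' hδ A wallZeroClass_restrict' hB).mono ?_
  intro D _ χ _ _ hflat hA N hN₁ hN₂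
  exact not_lt.2 (hflat hA d.g h N hN₁ hN₂)

/-- family «wall value zero, from the wall to any bounded length, TRUE-BAND slot displayed (E-004 in its final form)».
[cite: Zhang2022LandauSiegel, §2 (2.16)–(2.20), (2.30); §8 Lemma 8.1] -/
def familyWallZeroTrueBand : DesignFamily where
  Design := WallZeroDesign
  InClass := WallZeroDesign.InClass
  Verdict := WallZeroDesign.VerdictTrueBand

/-- **`familyWallZeroTrueBand` is decided.** [cite: Zhang2022LandauSiegel, §2 (2.16)–(2.20); §8 Lemma 8.1] -/
theorem familyWallZeroTrueBand_decided : familyWallZeroTrueBand.Decided :=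
  fun d h => WallZeroDesign.verdictTrueBand_of_inClass d h

/-- **Verdict (true band, top-vanishing)**: the FULL polynomial, every `N ≥ ⌈P⌉`.
[cite: Zhang2022LandauSiegel, §2 (2.16)–(2.20), (2.30)–(2.31)] -/
def WallZeroTopDesign.VerdictTrueBand (d : WallZeroTopDesign) : Prop :=
  ∀ (A : ℕ) (η : ℝ), DiscMeanTrueBand d.c' (1058 + 2 * A) η →
    Skeleton.ForAllLarge fun D _ χ =>
      (∀ i ∈ Skeleton.idx χ, (i.2).re = 1 / 2) →
        ∀ N : ℕ, ⌈Skeleton.bigP D⌉₊ ≤ N →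
          ¬ (η * (discMeanAbs d.c' χ d.g ⌈Skeleton.bigP D⌉₊ + Skeleton.frakA χ * frakP D) +
                (Skeleton.ell D ^ A)⁻¹ *
                  (discMeanAbs d.c' χ d.g (bandEdge D (1058 + 2 * A)) + discWeight d.c' χ) <
              |discMean d.c' χ d.g N - discMean d.c' χ d.g ⌈Skeleton.bigP D⌉₊|)

/-- **The slice theorem (true band, top-vanishing).** [cite: Zhang2022LandauSiegel, §2 (2.16)–(2.20); §8 Lemma 8.1] -/
theorem WallZeroTopDesign.verdictTrueBand_of_inClass (d : WallZeroTopDesign) (h : d.InClass) :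
    d.VerdictTrueBand := by
  intro A η hB
  refine (discMean_fromWall_topVanishing_of_trueBandOn d.c' d.θ A wallZeroClass_restrict' hB).mono ?_
  intro D _ χ _ _ hflat hA N hN₁
  exact not_lt.2 (hflat hA d.g h.1 h.2 N hN₁)

/-- family «wall value zero, top-vanishing, full polynomial vs bulk, TRUE-BAND slot displayed».
[cite: Zhang2022LandauSiegel, §2 (2.16)–(2.20), (2.30); §8 Lemma 8.1] -/
def familyWallZeroTopTrueBand : DesignFamily where
  Design := WallZeroTopDesign
  InClass := WallZeroTopDesign.InClass
  Verdict := WallZeroTopDesign.VerdictTrueBand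

/-- **`familyWallZeroTopTrueBand` is decided.** [cite: Zhang2022LandauSiegel, §2 (2.16)–(2.20); §8 Lemma 8.1] -/
theorem familyWallZeroTopTrueBand_decided : familyWallZeroTopTrueBand.Decided :=
  fun d h => WallZeroTopDesign.verdictTrueBand_of_inClass d h

/-- C4: the triangular overhang is a member of both true-band rows (same classes as p459259).
[cite: Zhang2022LandauSiegel, §7 (7.2) p.44] -/
theorem familyWallZeroTrueBand_inClass_triangle (c' : ℝ) {θ : ℝ} (hθ : 1 ≤ θ) (hθ3 : θ ≤ 3) :
    familyWallZeroTrueBand.InClass (WallZeroDesign.mk c' fun y => ((max 0 (min (y - 1) (θ - y)) : ℝ) : ℂ)) ∧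
      familyWallZeroTopTrueBand.InClass
        (WallZeroTopDesign.mk ⟨c', fun y => ((max 0 (min (y - 1) (θ - y)) : ℝ) : ℂ)⟩ θ) :=
  ⟨inClass_triangle c' hθ hθ3, inClassTop_triangle c' hθ hθ3⟩

/-- **`R⁺⁺`-step of this file**: `ClassDecided (Rplus ++ [familyWallZeroTrueBand, familyWallZeroTopTrueBand])`.
[cite: Zhang2022LandauSiegel, §2 (2.32)–(2.33); §7 (7.2) p.44] -/
theorem rplus_wallZeroTrueBand_decided :
    ClassDecided (Rplus ++ [familyWallZeroTrueBand, familyWallZeroTopTrueBand]) :=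
  classDecided_append.2
    ⟨rplus_decided, classDecided_cons familyWallZeroTrueBand_decided
      (classDecided_cons familyWallZeroTopTrueBand_decided classDecided_nil)⟩

end Repair

end Literature.NumberTheory.LFunctions.Zhang2022
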